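import Literature.ModelTheory.Quasiminimal.Splitting
import HarnessLib

/-!
# Isolation of types over a closed set and a finite tuple (BHHKK 2014, Prop. 5.2)

M. Bays, B. Hart, T. Hyttinen, M. Kesälä, J. Kirby, *Quasiminimal structures and excellence*,
Bull. London Math. Soc. 46 (2014) 155–163, §5:

* **Definition 5.1.** For `A ⊆ 𝔐` and `ā ∈ cl(A)`, `tp(ā/A)` is *s-isolated* if there is a
  finite `A₀ ⊆ A` such that `tp(b̄/A₀) = tp(ā/A₀)` implies `tp(b̄/A) = tp(ā/A)` (for
  `b̄ ∈ cl(A)`; Shelah's `F^s_{ℵ₀}`-isolation).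
* **Proposition 5.2.** Let `M ◁ 𝔐` be a countable closed submodel and `ā, b̄ ∈ 𝔐` finite tuples
  with `b̄ ∈ cl(Mā)`. Then `tp(b̄/M ∪ ā)` is s-isolated.

As in `Splitting.lean`, the ambient countable structure is our `M` (BHHKK's `𝔐`, "we may assume
`𝔐` to be countable") and BHHKK's `M` is a closed `C ⊆ M`. We prove Prop. 5.2 in the slightly
stronger form where the competitor tuple `b̄'` is arbitrary (if `tp(b̄'/Aā) = tp(b̄/Aā)` then
`b̄' ∈ cl(Aā)` automatically, by QM1), following BHHKK's proof: choose by Prop. 4.2 a finite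
`A ⊆ C` over which `tp(āb̄/C)` does not split, enlarge it so that `ā` is independent from `C`
over `A` and `b̄ ∈ cl(Aā)`; then for `d̄ ∈ C` produce `d̄' ∈ C` with
`tp(b̄'d̄/Aā) = tp(b̄d̄'/Aā)` (Claim 1: split `d̄` into a part independent over `cl(Aā)`, fixed
by uniqueness of the generic type, and a part in its closure, moved by `ℵ₀`-homogeneity) and
conclude by non-splitting.

## Contents

* rearrangement lemmas for `EqQFTypeOver P id` (`EqQFTypeOver.of_subset_agree`,
  `….union_range_of_append`, `….append_of_union_range`, `….append_swap`), `NotSplitOver.mono`;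
* `IsPregeometry.mem_cl_of_mem_cl_union_of_indepFamilyOver` — if `b` is independent over `C`,
  `S ⊆ C` and `x ∈ C ∩ cl (S ∪ range b)` then `x ∈ cl S`;
* `IsWeaklyQuasiminimalPregeometryStructure.exists_isolation` — Prop. 5.2.

## References

* M. Bays, B. Hart, T. Hyttinen, M. Kesälä, J. Kirby, *Quasiminimal structures and excellence*,
  Bull. London Math. Soc. 46 (2014) 155–163, arXiv:1210.2008: Def. 5.1, Prop. 5.2.
-/

noncomputable section

open Set FirstOrder FirstOrder.Language
open scoped Matroid

universe u v w

namespace Literature.ModelTheory.Quasiminimal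

variable {L : Language.{u, v}} {M : Type w} [L.Structure M] {cl : Set M → Set M}

/-! ### Rearranging `EqQFTypeOver P id` -/

section Rearrangements

variable {P : Set M} {n k : ℕ}

/-- Parameters on which the two tuples agree may be added to the base: if `tp(x̄/P) = tp(ȳ/P)`
and `Q ⊆ P ∪ {xᵢ : xᵢ = yᵢ}` then `tp(x̄/Q) = tp(ȳ/Q)`. [folklore] -/
theorem _root_.FirstOrder.Language.EqQFTypeOver.of_subset_agree {x y : Fin n → M}
    (h : L.EqQFTypeOver P id x y) {Q : Set M} (hQ : Q ⊆ P ∪ {b | ∃ i, x i = b ∧ y i = b}) :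
    L.EqQFTypeOver Q id x y := by
  classical
  intro m τ hτ
  let s : Finset (Fin m) := Finset.univ.filter fun j => τ j ∈ P
  let e : Fin s.card ≃ s := (Finset.equivFin s).symm
  let p : Fin s.card → M := fun j => τ (e j)
  have hp : ∀ j, p j ∈ P := fun j => (Finset.mem_filter.1 (e j).2).2
  have hsel : ∀ j : Fin m, τ j ∉ P → ∃ i, x i = τ j ∧ y i = τ j := fun j hj => by
    rcases hQ (hτ j) with h | ⟨i, hi, hi'⟩
    · exact absurd h hj
    · exact ⟨i, hi, hi'⟩
  let κ₀ : Fin m → Fin (s.card + n) := fun j =>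
    if hj : τ j ∈ P then Fin.castAdd n (e.symm ⟨j, Finset.mem_filter.2 ⟨Finset.mem_univ _, hj⟩⟩)
    else Fin.natAdd s.card (hsel j hj).choose
  let κ : Fin (m + n) → Fin (s.card + n) := fun j =>
    Fin.addCases κ₀ (fun i => Fin.natAdd s.card i) j
  have key := h p hp
  simp only [Function.id_comp] at key ⊢
  have h1 : Fin.append p x ∘ κ = Fin.append τ x := by
    funext j
    refine Fin.addCases (fun j => ?_) (fun i => ?_) j
    · by_cases hj : τ j ∈ P
      · simp [κ, κ₀, hj, p]
      · simp only [κ, κ₀, Function.comp_apply, Fin.addCases_left, dif_neg hj, Fin.append_right,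
          Fin.append_left]
        exact (hsel j hj).choose_spec.1
    · simp [κ]
  have h2 : Fin.append p y ∘ κ = Fin.append τ y := by
    funext j
    refine Fin.addCases (fun j => ?_) (fun i => ?_) j
    · by_cases hj : τ j ∈ P
      · simp [κ, κ₀, hj, p]
      · simp only [κ, κ₀, Function.comp_apply, Fin.addCases_left, dif_neg hj, Fin.append_right,
          Fin.append_left]
        exact (hsel j hj).choose_spec.2
    · simp [κ]
  have := key.comp κ
  rwa [h1, h2] at this

/-- `tp(x̄z̄/P) = tp(ȳz̄/P)` implies `tp(x̄/P z̄) = tp(ȳ/P z̄)`. [folklore] -/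
theorem _root_.FirstOrder.Language.EqQFTypeOver.union_range_of_append {x y : Fin n → M}
    {z : Fin k → M} (h : L.EqQFTypeOver P id (Fin.append x z) (Fin.append y z)) :
    L.EqQFTypeOver (P ∪ range z) id x y := by
  have h1 : L.EqQFTypeOver (P ∪ range z) id (Fin.append x z) (Fin.append y z) := by
    refine h.of_subset_agree ?_
    rintro b (hb | ⟨i, rfl⟩)
    · exact Or.inl hb
    · exact Or.inr ⟨Fin.natAdd n i, by simp, by simp⟩
  have := h1.comp_right (Fin.castAdd k)
  have ex : Fin.append x z ∘ Fin.castAdd k = x := funext fun i => by simp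
  have ey : Fin.append y z ∘ Fin.castAdd k = y := funext fun i => by simp
  rwa [ex, ey] at this

/-- `tp(x̄/P z̄) = tp(ȳ/P z̄)` implies `tp(x̄z̄/P) = tp(ȳz̄/P)`. [folklore] -/
theorem _root_.FirstOrder.Language.EqQFTypeOver.append_of_union_range {x y : Fin n → M}
    {z : Fin k → M} (h : L.EqQFTypeOver (P ∪ range z) id x y) :
    L.EqQFTypeOver P id (Fin.append x z) (Fin.append y z) := by
  intro m τ hτ
  have hmem : ∀ j, Fin.append τ z j ∈ P ∪ range z := fun j => by
    refine Fin.addCases (fun j => ?_) (fun j => ?_) j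
    · simpa using Or.inl (hτ j)
    · simp
  have key := h (Fin.append τ z) hmem
  simp only [Function.id_comp] at key ⊢
  let κ : Fin (m + (n + k)) → Fin (m + k + n) := fun j =>
    Fin.addCases (fun j => Fin.castAdd n (Fin.castAdd k j))
      (fun j => Fin.addCases (fun i => Fin.natAdd (m + k) i)
        (fun i => Fin.castAdd n (Fin.natAdd m i)) j) j
  have h1 : Fin.append (Fin.append τ z) x ∘ κ = Fin.append τ (Fin.append x z) := by
    funext j
    refine Fin.addCases (fun j => ?_) (fun j => ?_) j
    · simp [κ]
    · refine Fin.addCases (fun i => ?_) (fun i => ?_) j <;> simp [κ]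
  have h2 : Fin.append (Fin.append τ z) y ∘ κ = Fin.append τ (Fin.append y z) := by
    funext j
    refine Fin.addCases (fun j => ?_) (fun j => ?_) j
    · simp [κ]
    · refine Fin.addCases (fun i => ?_) (fun i => ?_) j <;> simp [κ]
  have := key.comp κ
  rwa [h1, h2] at this

/-- Swapping the blocks of concatenated tuples. [folklore] -/
theorem _root_.FirstOrder.Language.EqQFTypeOver.append_swap {f : M → M} {x y : Fin n → M}
    {z w : Fin k → M} (h : L.EqQFTypeOver P f (Fin.append x z) (Fin.append y w)) :
    L.EqQFTypeOver P f (Fin.append z x) (Fin.append w y) := by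
  let κ : Fin (k + n) → Fin (n + k) := fun j =>
    Fin.addCases (fun j => Fin.natAdd n j) (fun i => Fin.castAdd k i) j
  have := h.comp_right κ
  have e1 : Fin.append x z ∘ κ = Fin.append z x := by
    funext j
    refine Fin.addCases (fun j => ?_) (fun i => ?_) j <;> simp [κ]
  have e2 : Fin.append y w ∘ κ = Fin.append w y := by
    funext j
    refine Fin.addCases (fun j => ?_) (fun i => ?_) j <;> simp [κ]
  rwa [e1, e2] at this

end Rearrangements

/-! ### Non-splitting is preserved under enlarging the base inside `C` -/

/-- If `tp(ā/C)` does not split over `A` then it does not split over any finite `A'` with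
`A ⊆ A' ⊆ C` (BHHKK 2014, proof of Prop. 5.2: "We may suppose (extending `A`) …").
[cite: BHHKK2014, Prop. 5.2 (proof)] -/
theorem NotSplitOver.mono {C : Set M} {n : ℕ} {a : Fin n → M} {A A' : Set M}
    (h : NotSplitOver L C a A) (hAA' : A ⊆ A') (hA'C : A' ⊆ C) (hA'fin : A'.Finite) :
    NotSplitOver L C a A' := by
  intro m c d hc hd hcd
  obtain ⟨k, p, hp⟩ := hA'fin.fin_embedding
  have hpA' : ∀ j, p j ∈ A' := fun j => hp ▸ mem_range_self j
  -- `tp(p̄c̄/A) = tp(p̄d̄/A)`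
  have h1 : L.EqQFTypeOver A id (Fin.append (p : Fin k → M) c) (Fin.append (p : Fin k → M) d) := by
    have : L.EqQFTypeOver (A ∪ range p) id c d := by
      refine eqQFTypeOver_id_mono ?_ hcd
      rw [hp]
      exact union_subset hAA' Subset.rfl
    exact this.append_of_union_range.append_swap
  have hpc : ∀ i, Fin.append (p : Fin k → M) c i ∈ C := fun i => by
    refine Fin.addCases (fun j => ?_) (fun j => ?_) i
    · simpa using hA'C (hpA' j)
    · simpa using hc j
  have hpd : ∀ i, Fin.append (p : Fin k → M) d i ∈ C := fun i => by
    refine Fin.addCases (fun j => ?_) (fun j => ?_) i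
    · simpa using hA'C (hpA' j)
    · simpa using hd j
  have h2 := h _ _ hpc hpd h1
  -- back to `c̄`, `d̄` over `A ∪ ā ∪ p̄ ⊇ A' ∪ ā`
  have h3 := h2.append_swap.union_range_of_append
  refine eqQFTypeOver_id_mono ?_ h3
  rw [hp]
  rintro x (hx | hx)
  · exact Or.inr hx
  · exact Or.inl (Or.inr hx)

/-! ### Independence over a set kills parameters outside -/

/-- **Independent families are free from `C`.** If `b` is independent over `C`, `S ⊆ C` and
`x ∈ C` lies in `cl (S ∪ range b)`, then already `x ∈ cl S` (exchange: otherwise some `b i`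
would fall into the closure of `C` and the other members). Used in BHHKK 2014, proof of
Prop. 5.2 ("By the independence of `ā` from `M` over `A`, in fact `d̄₂ ∈ cl(Ad̄₁)`").
[folklore] -/
theorem IsPregeometry.mem_cl_of_mem_cl_union_of_indepFamilyOver (h : IsPregeometry cl)
    {C S : Set M} {ι : Type*} {b : ι → M} (hb : IndepFamilyOver cl C b) (hS : S ⊆ C) {x : M}
    (hx : x ∈ C) (hxcl : x ∈ cl (S ∪ range b)) : x ∈ cl S := by
  classical
  obtain ⟨T, hT, hTfin, hxT⟩ := h.finite_character hxcl
  -- induction on the finite set of members of the family that are used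
  have key : ∀ F : Finset M, (↑F : Set M) ⊆ range b → x ∈ cl (S ∪ ↑F) → x ∈ cl S := by
    intro F
    induction F using Finset.induction_on with
    | empty => intro _ hx'; simpa using hx'
    | insert y F hyF ih =>
      intro hF hx'
      rw [Finset.coe_insert] at hF hx'
      have hFb : (↑F : Set M) ⊆ range b := (subset_insert _ _).trans hF
      by_cases hx'' : x ∈ cl (S ∪ ↑F)
      · exact ih hFb hx''
      · exfalso
        rw [union_insert] at hx'
        have hy := h.exchange hx' hx''
        obtain ⟨i, rfl⟩ := hF (mem_insert _ _)
        refine hb i (h.mono ?_ hy)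
        rintro z (rfl | hz | hz)
        · exact Or.inl hx
        · exact Or.inl (hS hz)
        · obtain ⟨j, rfl⟩ := hFb hz
          refine Or.inr ⟨j, fun hji => hyF ?_, rfl⟩
          have hji' : j = i := hji
          subst hji'
          simpa using hz
  have hTS : T ⊆ S ∪ ↑(hTfin.inter_of_left (range b)).toFinset := by
    intro t ht
    rcases hT ht with h1 | h1
    · exact Or.inl h1
    · exact Or.inr (by simpa using ⟨ht, h1⟩)
  refine key _ (by simp) (h.mono hTS hxT)

/-- **Bases of a set over another set**: for `C, X ⊆ M` there is `I ⊆ X` independent over `C`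
with `X ⊆ cl (C ∪ I)` (a basis of `X` in the contraction `matroid ／ C`). [folklore] -/
theorem IsPregeometry.exists_indep_basis_over (h : IsPregeometry cl) (C X : Set M) :
    ∃ I : Set M, I ⊆ X ∧ IndepFamilyOver cl C ((↑) : I → M) ∧ X ⊆ cl (C ∪ I) := by
  obtain ⟨I, hI⟩ := (h.matroid ／ C).exists_isBasis' X
  refine ⟨I, hI.subset, h.indepFamilyOver_of_contract_indep Subtype.coe_injective
    (by rw [Subtype.range_coe]; exact hI.indep), fun x hx => ?_⟩
  by_cases hxC : x ∈ C
  · exact h.subset_cl _ (Or.inl hxC)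
  · have hB := hI.isBasis_inter_ground
    have hx' : x ∈ X ∩ (h.matroid ／ C).E := ⟨hx, by simp [hxC]⟩
    have := hB.subset_closure hx'
    rw [Matroid.contract_closure_eq, h.matroid_closure] at this
    rw [union_comm]
    exact this.1

/-! ### QM1 along `tp(·/X)` -/

/-- If `tp(b̄/X) = tp(b̄'/X)` and `b j ∈ cl X` then `b' j ∈ cl X`. [cite: BHHKK2014, Def. 2.1 (QM1)] -/
theorem mem_cl_of_eqQFTypeOver_id (hW : IsWeaklyQuasiminimalPregeometryStructure L M cl)
    {X : Set M} {l : ℕ} {b b' : Fin l → M} (h : L.EqQFTypeOver X id b b') (j : Fin l)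
    (hj : b j ∈ cl X) : b' j ∈ cl X := by
  have hP := hW.isPregeometry
  obtain ⟨X₀, hX₀, hX₀fin, hjX₀⟩ := hP.finite_character hj
  obtain ⟨k, σ, hσ⟩ := hX₀fin.fin_embedding
  have hσX : ∀ i, σ i ∈ X := fun i => hX₀ (hσ ▸ mem_range_self i)
  have key := h σ hσX
  simp only [Function.id_comp] at key
  let κ : Fin (k + 1) → Fin (k + l) := fun i =>
    Fin.addCases (fun i => Fin.castAdd l i) (fun _ => Fin.natAdd k j) i
  have := key.comp κ
  have e1 : Fin.append (σ : Fin k → M) b ∘ κ = Fin.append (σ : Fin k → M) ![b j] := by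
    funext i
    refine Fin.addCases (fun i => ?_) (fun i => ?_) i
    · simp [κ]
    · simp [κ, Fin.fin_one_eq_zero i]
  have e2 : Fin.append (σ : Fin k → M) b' ∘ κ = Fin.append (σ : Fin k → M) ![b' j] := by
    funext i
    refine Fin.addCases (fun i => ?_) (fun i => ?_) i
    · simp [κ]
    · simp [κ, Fin.fin_one_eq_zero i]
  rw [e1, e2, Fin.append_right_eq_snoc, Fin.append_right_eq_snoc, Matrix.cons_val_fin_one,
    Matrix.cons_val_fin_one] at this
  have hj' : b j ∈ cl (range σ) := by rw [hσ]; exact hjX₀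
  exact hP.mono (hσ.symm ▸ hX₀ : range (σ : Fin k → M) ⊆ X) (hW.mem_cl_of_eqQFType _ _ _ _ this hj')

/-! ### Proposition 5.2 -/

namespace IsWeaklyQuasiminimalPregeometryStructure

omit [L.Structure M] in
/-- Reassociating a triple concatenation. [folklore] -/
theorem append_assoc_comp_cast {p q r : ℕ} (x : Fin p → M) (y : Fin q → M) (z : Fin r → M) :
    Fin.append (Fin.append x y) z ∘ Fin.cast (Nat.add_assoc p q r).symm =
      Fin.append x (Fin.append y z) := by
  rw [Fin.append_assoc]
  funext i
  rfl

/-- **BHHKK 2014, Prop. 5.2: types inside the closure of a closed set and a finite tuple are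
s-isolated.** Let `M` be a countable weakly quasiminimal pregeometry structure, `C ⊆ M`
closed, `ā` a finite tuple and `b̄` a tuple from `cl (C ∪ ā)`. Then there is a finite
`A₀ ⊆ C ∪ ā` such that every `b̄'` with `tp(b̄'/A₀) = tp(b̄/A₀)` has `tp(b̄'/C ∪ ā) = tp(b̄/C ∪ ā)`.
(We take `A₀ = A ∪ ā` with `A ⊆ C` finite such that `tp(āb̄/C)` does not split over `A`,
`ā` is independent from `C` over `A` and `b̄ ∈ cl(Aā)`; the restriction `b̄' ∈ cl(C ∪ ā)` of
Def. 5.1 is then automatic.) [cite: BHHKK2014, Prop. 5.2] -/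
theorem exists_isolation [Countable M] (hW : IsWeaklyQuasiminimalPregeometryStructure L M cl)
    {C : Set M} (hC : cl C = C) {n l : ℕ} (a : Fin n → M) {b : Fin l → M}
    (hb : ∀ j, b j ∈ cl (C ∪ range a)) :
    ∃ A₀ : Set M, A₀.Finite ∧ A₀ ⊆ C ∪ range a ∧
      ∀ b' : Fin l → M, L.EqQFTypeOver A₀ id b b' → L.EqQFTypeOver (C ∪ range a) id b b' := by
  classical
  have hP := hW.isPregeometry
  -- S1: non-splitting base for `tp(āb̄/C)`
  obtain ⟨A₁, hA₁fin, hA₁C, hns₁⟩ := hW.exists_notSplitOver hC (Fin.append a b)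
  -- S2: the part of `ā` independent over `C`, and a finite support of `ā` over it
  obtain ⟨I, hIa, hI, haI⟩ := hP.exists_indep_basis_over C (range a)
  have hIC' : ∀ i, a i ∈ cl (C ∪ I) := fun i => haI (mem_range_self i)
  choose T hT hTfin haT using fun i => hP.finite_character (hIC' i)
  set A₂ : Set M := ⋃ i, T i ∩ C with hA₂
  have hA₂fin : A₂.Finite := finite_iUnion fun i => (hTfin i).inter_of_left C
  have hA₂C : A₂ ⊆ C := iUnion_subset fun i => inter_subset_right
  have haA₂ : ∀ i, a i ∈ cl (A₂ ∪ I) := fun i => by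
    refine hP.mono (fun t ht => ?_) (haT i)
    rcases hT i ht with htC | htI
    · exact Or.inl (mem_iUnion.2 ⟨i, ht, htC⟩)
    · exact Or.inr htI
  -- S3: a finite support of `b̄` over `C`, given `ā`
  choose T' hT' hT'fin hbT' using fun j => hP.finite_character (hb j)
  set A₃ : Set M := ⋃ j, T' j ∩ C with hA₃
  have hA₃fin : A₃.Finite := finite_iUnion fun j => (hT'fin j).inter_of_left C
  have hA₃C : A₃ ⊆ C := iUnion_subset fun j => inter_subset_right
  have hbA₃ : ∀ j, b j ∈ cl (A₃ ∪ range a) := fun j => by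
    refine hP.mono (fun t ht => ?_) (hbT' j)
    rcases hT' j ht with htC | hta
    · exact Or.inl (mem_iUnion.2 ⟨j, ht, htC⟩)
    · exact Or.inr hta
  -- S4: the base `A`
  set A : Set M := A₁ ∪ (A₂ ∪ A₃) with hA
  have hAfin : A.Finite := hA₁fin.union (hA₂fin.union hA₃fin)
  have hAC : A ⊆ C := union_subset hA₁C (union_subset hA₂C hA₃C)
  have hns : NotSplitOver L C (Fin.append a b) A := hns₁.mono subset_union_left hAC hAfin
  have haA : ∀ i, a i ∈ cl (A ∪ I) := fun i =>
    hP.mono (union_subset_union_left _ (subset_union_left.trans subset_union_right)) (haA₂ i)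
  set X : Set M := A ∪ range a with hX
  have hbX : ∀ j, b j ∈ cl X := fun j =>
    hP.mono (union_subset_union_left _ (subset_union_right.trans subset_union_right)) (hbA₃ j)
  have hXfin : X.Finite := hAfin.union (finite_range a)
  set H : Set M := cl X with hH
  have hHcl : cl H = H := hP.cl_cl _
  have hXH : X ⊆ H := hP.subset_cl _
  have hHC : H ⊆ cl (C ∪ range a) := hP.mono (union_subset_union_left _ hAC)
  refine ⟨X, hXfin, union_subset_union_left _ hAC, fun b' hbb' => ?_⟩
  -- `b̄' ∈ cl X` as well
  have hb'X : ∀ j, b' j ∈ cl X := fun j => mem_cl_of_eqQFTypeOver_id hW hbb' j (hbX j)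
  -- enumerate `A`
  obtain ⟨kA, xA, hxA⟩ := hAfin.fin_embedding
  have hxAA : ∀ i, xA i ∈ A := fun i => hxA ▸ mem_range_self i
  -- (c) the partial embedding `F : H → H` fixing `A ∪ ā` with `b̄' ↦ b̄`
  let t : Fin (kA + (n + l)) → M := Fin.append (xA : Fin kA → M) (Fin.append a b')
  let t' : Fin (kA + (n + l)) → M := Fin.append (xA : Fin kA → M) (Fin.append a b)
  have htt' : L.EqQFType t t' := by
    have hmem : ∀ i, Fin.append (xA : Fin kA → M) a i ∈ X := fun i => by
      refine Fin.addCases (fun j => ?_) (fun j => ?_) i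
      · rw [Fin.append_left]; exact Or.inl (hxAA j)
      · rw [Fin.append_right]; exact Or.inr (mem_range_self j)
    have := (eqQFTypeOver_id_symm hbb') (Fin.append (xA : Fin kA → M) a) hmem
    simp only [Function.id_comp] at this
    have := this.comp (Fin.cast (Nat.add_assoc kA n l).symm)
    rwa [append_assoc_comp_cast, append_assoc_comp_cast] at this
  have h00 : L.EqQFTypeOver (∅ : Set M) id t t' := eqQFTypeOver_empty_iff.2 htt'
  obtain ⟨F, hF, -, hFt, hFim⟩ := hW.exists_isQFEmbOn_cl_extend (f := id) countable_empty
    (Or.inr rfl) h00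
  have hranget : range t = X ∪ range b' := by
    simp only [t, range_append, hxA, hX, union_assoc]
  have hranget' : range t' = X ∪ range b := by
    simp only [t', range_append, hxA, hX, union_assoc]
  have hclt : cl (∅ ∪ range t) = H := by
    rw [empty_union, hranget]
    refine Subset.antisymm ?_ (hP.mono subset_union_left)
    calc cl (X ∪ range b') ⊆ cl (cl X) := hP.mono (union_subset (hP.subset_cl X)
          (range_subset_iff.2 hb'X))
      _ = cl X := hP.cl_cl X
  have hclt' : cl (id '' ∅ ∪ range t') = H := by
    rw [image_empty, empty_union, hranget']
    refine Subset.antisymm ?_ (hP.mono subset_union_left)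
    calc cl (X ∪ range b) ⊆ cl (cl X) := hP.mono (union_subset (hP.subset_cl X)
          (range_subset_iff.2 hbX))
      _ = cl X := hP.cl_cl X
  rw [hclt] at hF
  rw [hclt, hclt'] at hFim
  have hFA : ∀ i, F (xA i) = xA i := fun i => by
    have := hFt (Fin.castAdd (n + l) i); simpa [t, t'] using this
  have hFa : ∀ i, F (a i) = a i := fun i => by
    have := hFt (Fin.natAdd kA (Fin.castAdd l i)); simpa [t, t'] using this
  have hFb' : ∀ j, F (b' j) = b j := fun j => by
    have := hFt (Fin.natAdd kA (Fin.natAdd n j)); simpa [t, t'] using this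
  have hFX : ∀ x ∈ X, F x = x := by
    rintro x (hx | ⟨i, rfl⟩)
    · obtain ⟨i, rfl⟩ : x ∈ range xA := hxA ▸ hx
      exact hFA i
    · exact hFa i
  -- main step: for every `d̄ ∈ C` there is `d̄' ∈ C` with `tp(b̄'d̄/X) = tp(b̄d̄'/X)`
  have claim : ∀ {m : ℕ} (d : Fin m → M), (∀ j, d j ∈ C) →
      ∃ d' : Fin m → M, (∀ j, d' j ∈ C) ∧
        L.EqQFTypeOver X id (Fin.append b' d) (Fin.append b d') := by
    intro m d hd
    -- (d) the part of `d̄` independent over `H`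
    obtain ⟨J, hJd, hJ, hdJ⟩ := hP.exists_indep_basis_over H (range d)
    have hJC : J ⊆ C := hJd.trans (range_subset_iff.2 hd)
    have hGhyp : (cl H = H ∧ cl (F '' H) = F '' H) ∨ H = ∅ := Or.inl ⟨hHcl, by rw [hFim]; exact hHcl⟩
    have hJ' : IndepFamilyOver cl (F '' H) ((↑) : J → M) := by rw [hFim]; exact hJ
    obtain ⟨G, hG, hGF, hGJ, -⟩ := hW.exists_isQFEmbOn_extend_indepFamily hGhyp hF hJ hJ'
    rw [Subtype.range_coe] at hG
    -- (e) `d̄ ⊆ cl (A ∪ J)`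
    have hdAJ : ∀ j, d j ∈ cl (A ∪ J) := by
      intro j
      have h1 : d j ∈ cl (A ∪ J ∪ range ((↑) : I → M)) := by
        rw [Subtype.range_coe]
        have h2 : d j ∈ cl (H ∪ J) := hdJ (mem_range_self j)
        rw [hH, hP.cl_cl_union] at h2
        refine (hP.mono ?_).trans (hP.cl_cl (A ∪ J ∪ I)).subset |> fun hh => hh h2
        rintro x ((hx | ⟨i, rfl⟩) | hx)
        · exact hP.subset_cl _ (Or.inl (Or.inl hx))
        · exact hP.mono (union_subset_union_left _ subset_union_left) (haA i)
        · exact hP.subset_cl _ (Or.inl (Or.inr hx))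
      exact hP.mem_cl_of_mem_cl_union_of_indepFamilyOver hI (union_subset hAC hJC) (hd j) h1
    have hdom : ∀ j, d j ∈ cl (H ∪ J) := fun j =>
      hP.mono (union_subset_union_left _ (subset_union_left.trans hXH)) (hdAJ j)
    -- the tuple `d̄'`
    refine ⟨G ∘ d, fun j => ?_, ?_⟩
    · -- `d' j ∈ C`
      have hsub : A ∪ J ⊆ cl (H ∪ J) :=
        union_subset (subset_union_left.trans (hXH.trans (subset_union_left.trans
          (hP.subset_cl _)))) (subset_union_right.trans (hP.subset_cl _))
      have h1 := hG.mem_cl_image hW hsub (hdom j) (hdAJ j)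
      have himg : G '' (A ∪ J) = A ∪ J := by
        refine (image_congr fun x hx => ?_).trans (image_id _)
        rcases hx with hx | hx
        · rw [hGF (hXH (Or.inl hx))]; exact hFX x (Or.inl hx)
        · obtain ⟨y, rfl⟩ : x ∈ range ((↑) : J → M) := by rw [Subtype.range_coe]; exact hx
          exact hGJ y
      rw [himg] at h1
      rw [← hC]
      exact hP.mono (union_subset hAC hJC) h1
    · -- `tp(b̄'d̄/X) = tp(b̄ (G d̄)/X)` via the partial embedding `G`
      intro m' τ hτ
      have hmem : ∀ i, Fin.append τ (Fin.append b' d) i ∈ cl (H ∪ J) := fun i => by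
        refine Fin.addCases (fun j => ?_) (fun j => ?_) i
        · simpa using hP.subset_cl _ (Or.inl (hXH (hτ j)))
        · refine Fin.addCases (fun j' => ?_) (fun j' => ?_) j
          · simpa using hP.subset_cl _ (Or.inl (hb'X j'))
          · simpa using hdom j'
      have := hG _ hmem
      have e1 : G ∘ Fin.append τ (Fin.append b' d) = Fin.append (id ∘ τ) (Fin.append b (G ∘ d)) := by
        funext i
        refine Fin.addCases (fun j => ?_) (fun j => ?_) i
        · simpa using (hGF (hXH (hτ j))).trans (hFX _ (hτ j))
        · refine Fin.addCases (fun j' => ?_) (fun j' => ?_) j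
          · simpa using (hGF (hb'X j')).trans (hFb' j')
          · simp
      rwa [e1] at this
  -- S7: conclusion
  rw [eqQFTypeOver_id_iff_finite]
  intro P₀ hP₀ hP₀fin
  obtain ⟨m, d, hd⟩ := (hP₀fin.inter_of_left C).fin_embedding
  have hdC : ∀ j, d j ∈ C := fun j => ((hd ▸ mem_range_self j : d j ∈ P₀ ∩ C)).2
  obtain ⟨d', hd'C, hclaim⟩ := claim d hdC
  -- (1) `tp(d̄/A) = tp(d̄'/A)`
  have h1 : L.EqQFTypeOver A id (d : Fin m → M) d' := by
    have := (eqQFTypeOver_id_mono (subset_union_left : A ⊆ X) hclaim).comp_right (Fin.natAdd l)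
    have e1 : Fin.append b' (d : Fin m → M) ∘ Fin.natAdd l = d := funext fun i => by simp
    have e2 : Fin.append b d' ∘ Fin.natAdd l = d' := funext fun i => by simp
    rwa [e1, e2] at this
  -- (2) non-splitting: `tp(d̄/A ā b̄) = tp(d̄'/A ā b̄)`
  have h2 := hns d d' hdC hd'C h1
  rw [range_append, ← union_assoc] at h2
  -- (3) rearrange: `tp(b̄ d̄/X) = tp(b̄ d̄'/X) = tp(b̄' d̄/X)`, hence `tp(b̄/X d̄) = tp(b̄'/X d̄)`
  have h3 : L.EqQFTypeOver X id (Fin.append b (d : Fin m → M)) (Fin.append b d') :=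
    h2.append_of_union_range.append_swap
  have h4 : L.EqQFTypeOver X id (Fin.append b (d : Fin m → M)) (Fin.append b' d) :=
    eqQFTypeOver_id_trans h3 (eqQFTypeOver_id_symm hclaim)
  have h5 : L.EqQFTypeOver (X ∪ range d) id b b' := h4.union_range_of_append
  refine eqQFTypeOver_id_mono ?_ h5
  intro x hx
  rcases hP₀ hx with hxC | hxa
  · exact Or.inr (hd.symm ▸ ⟨hx, hxC⟩ : x ∈ range d)
  · exact Or.inl (Or.inr hxa)

end IsWeaklyQuasiminimalPregeometryStructure

end Literature.ModelTheory.Quasiminimal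

end
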